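import Literature.AlgebraicGeometry.Modules.SheafHomLeft
import Literature.AlgebraicGeometry.Modules.SheafHomExact
import Mathlib.Algebra.Homology.Bifunctor
import Mathlib.Algebra.Homology.BifunctorHomotopy
import Mathlib.Algebra.Homology.QuasiIso
import Mathlib.Algebra.Homology.Embedding.CochainComplex
import HarnessLib

/-!
# Venture HSemireg — the internal Hom complex `𝓗om•(E•, F•)` of two cochain complexes of `𝒪_X`-modules

HONEST FRAMING. Kernel plumbing for the cell `pub-hsemireg` (lead rulings R-53(a)/R-54(c): a re-usable
carrier, NOT a «K2 result»): constructions and proved lemmas on real carriers (`X.Modules`, Mathlib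
`HomologicalComplex`); no hypothesis structures, no named facts, no claim about any variety; nothing here
bears on HC / HC_CM / HC_AV; no door / grade / report sentence of the cell changes. First half of piece (f)
of the cell's blueprint for a semiregularity map of a strictly perfect complex (the carrier on which a
trace `𝓗om•(E•, E• ⊗ G) → G` and the local-to-global comparison would later be defined).

* `sheafHomBifunctor X : X.Modulesᵒᵖ ⥤ X.Modules ⥤ X.Modules`, `(E, M) ↦ 𝓗om(E, M)` — the tree's internal
  Hom (`Modules/SheafHom*.lean`: `sheafHom`, `sheafHomMap`, `sheafHomMapLeft`) as a bifunctor, additive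
  in both variables.
* `dualComplex X E`: the complex `i ↦ op (E^{-i})` in `X.Modulesᵒᵖ`, differential `(-1)^j • (d_E)ᵒᵖ` into
  degree `j` (the dual-complex sign).
* `homComplex X E F := HomologicalComplex.mapBifunctor F (dualComplex X E) (sheafHomBifunctor X).flip (up ℤ)`:
  degree-`n` term `∐_{q + i = n} 𝓗om(E^{-i}, F^q) = ∐_p 𝓗om(E^p, F^{p+n})`; with Mathlib's total-complex
  signs (`ε₁ = 1`, `ε₂ (q, i) = (-1)^q`) and the dual sign, the differential on `𝓗om(E^p, F^q)` (`n = q - p`)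
  is **`ψ ↦ ψ ≫ d_F + (-1)^{n+1} • d_E ≫ ψ`** (`HomComplex.ι_D₁`, `HomComplex.ι_D₂`) — exactly the
  convention of Mathlib's `CochainComplex.HomComplex` (`Cochain.δ_v`), so `Σ_p 𝟙_{E^p}` is a `0`-cocycle.
* functoriality and homotopy invariance in `F•` (`HomComplex.map`, `mapHomotopy`, `mapHomotopyEquiv`);
  amplitude `E• ∈ [a, b]`, `F• ∈ [c, d]` ⟹ `𝓗om•(E•, F•) ∈ [c - b, d - a]` (instances);
* the column case `HomComplex.columnIso : 𝓗om•(E₀[0], F•) ≅ 𝓗om(E₀, –) ∘ F•`, natural in `F•`, and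
  **`HomComplex.quasiIso_map_single₀`**: for `E₀` finite locally free `𝓗om•(E₀[0], –)` preserves
  quasi-isomorphisms (`Modules/SheafHomExact.lean`) — base case of «bounded strictly perfect `E•` ⟹
  `𝓗om•(E•, –)` preserves quasi-isomorphisms» (NOT here; nor functoriality in `E•`, nor sections/`Γ`).

References: The Stacks project, *More on Algebra*, Section «Hom complexes», and Tag 01CM (internal Hom of modules); R. Hartshorne,
*Algebraic Geometry* (1977), II Ex. 1.15, II Ex. 5.1 (b), III.6. [StacksProject] [Hartshorne1977]
-/

noncomputable section

open CategoryTheory CategoryTheory.Limits AlgebraicGeometry Opposite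

universe u

namespace Summit.Ventures.HSemireg

open Literature.AlgebraicGeometry.Modules Literature.AlgebraicGeometry.Motives

variable (X : Scheme.{u})

/-! ## §1 The internal Hom as a bifunctor `Mod(𝒪_X)ᵒᵖ ⥤ Mod(𝒪_X) ⥤ Mod(𝒪_X)` -/

/-- **The internal Hom bifunctor** `(E, M) ↦ 𝓗om_{𝒪_X}(E, M)`: contravariant in `E`
(`sheafHomMapLeft`), covariant in `M` (`sheafHomMap`); naturality is the exchange law
`sheafHomMapLeft_sheafHomMap`. [cite: Hartshorne1977, II Ex. 1.15 and II.5 p. 109] -/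
def sheafHomBifunctor : X.Modulesᵒᵖ ⥤ X.Modules ⥤ X.Modules where
  obj E := sheafHomFunctor E.unop
  map {E₁ E₂} g :=
    { app := fun M => sheafHomMapLeft g.unop M
      naturality := fun M N f => (sheafHomMapLeft_sheafHomMap N g.unop f).symm }
  map_id E := by
    refine NatTrans.ext (funext fun M => ?_)
    change sheafHomMapLeft (𝟙 E.unop) M = 𝟙 (sheafHom E.unop M)
    exact sheafHomMapLeft_id M E.unop
  map_comp {E₁ E₂ E₃} g g' := by
    refine NatTrans.ext (funext fun M => ?_)
    change sheafHomMapLeft (g'.unop ≫ g.unop) M = sheafHomMapLeft g.unop M ≫ sheafHomMapLeft g'.unop M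
    exact sheafHomMapLeft_comp M g'.unop g.unop

/-- `𝓗om(E, f)` is post-composition. -/
@[simp]
lemma sheafHomBifunctor_obj_map (E : X.Modulesᵒᵖ) {M N : X.Modules} (f : M ⟶ N) :
    ((sheafHomBifunctor X).obj E).map f = sheafHomMap E.unop f := rfl

/-- `𝓗om(g, M)` is pre-composition. -/
@[simp]
lemma sheafHomBifunctor_map_app {E₁ E₂ : X.Modulesᵒᵖ} (g : E₁ ⟶ E₂) (M : X.Modules) :
    ((sheafHomBifunctor X).map g).app M = sheafHomMapLeft g.unop M := rfl

/-- `𝓗om(E, –)` is additive. -/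
instance (E : X.Modulesᵒᵖ) : ((sheafHomBifunctor X).obj E).Additive :=
  inferInstanceAs (sheafHomFunctor E.unop).Additive

/-- `𝓗om(–, M)` is additive. -/
instance : (sheafHomBifunctor X).Additive where
  map_add {E₁ E₂ g g'} := by
    refine NatTrans.ext (funext fun M => ?_)
    change sheafHomMapLeft (g.unop + g'.unop) M = sheafHomMapLeft g.unop M + sheafHomMapLeft g'.unop M
    exact sheafHomMapLeft_add M g.unop g'.unop

/-- The flipped bifunctor `(M, E) ↦ 𝓗om(E, M)` is additive in `M`. -/
instance : (sheafHomBifunctor X).flip.Additive where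

/-- The flipped bifunctor `(M, E) ↦ 𝓗om(E, M)` is additive in `E`. -/
instance (M : X.Modules) : ((sheafHomBifunctor X).flip.obj M).Additive where
  map_add {E₁ E₂ g g'} := by
    change sheafHomMapLeft (g.unop + g'.unop) M = sheafHomMapLeft g.unop M + sheafHomMapLeft g'.unop M
    exact sheafHomMapLeft_add M g.unop g'.unop

/-- Pre-composition `g ↦ 𝓗om(g, N)` as an additive homomorphism. -/
def sheafHomMapLeftAddHom (E₁ E₂ N : X.Modules) : (E₁ ⟶ E₂) →+ (sheafHom E₂ N ⟶ sheafHom E₁ N) where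
  toFun g := sheafHomMapLeft g N
  map_zero' := sheafHomMapLeft_zero N
  map_add' := sheafHomMapLeft_add N

/-- `𝓗om(u • g, N) = u • 𝓗om(g, N)` for a unit `u ∈ ℤˣ` (i.e. `±1`). -/
lemma sheafHomMapLeft_units_smul {E₁ E₂ : X.Modules} (u : ℤˣ) (g : E₁ ⟶ E₂) (N : X.Modules) :
    sheafHomMapLeft (u • g) N = u • sheafHomMapLeft g N := by
  rw [Units.smul_def, Units.smul_def]
  exact map_zsmul (sheafHomMapLeftAddHom X E₁ E₂ N) (u : ℤ) g

/-! ## §2 The dual complex `E•ᵒᵖ` with its sign, and the internal Hom complex -/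

/-- **The dual indexing of a cochain complex**: the cochain complex in `Mod(𝒪_X)ᵒᵖ` with degree-`i`
term `op (E^{-i})` and differential `(-1)^j • (d_E : E^{-j} → E^{-i})ᵒᵖ` in degrees `i → j`
(the sign convention of the dual complex, chosen so that `homComplex` below has the differential of
Mathlib's `CochainComplex.HomComplex`). [cite: StacksProject, More on Algebra, Section «Hom complexes»] -/
def dualComplex (E : CochainComplex X.Modules ℤ) : CochainComplex X.Modulesᵒᵖ ℤ where
  X i := op (E.X (-i))
  d i j := ((j.negOnePow : ℤˣ) • E.d (-j) (-i)).op
  shape i j hij := by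
    have h : ¬ (ComplexShape.up ℤ).Rel (-j) (-i) := fun h => hij (by simp at h ⊢; lia)
    rw [E.shape _ _ h, smul_zero, op_zero]
  d_comp_d' i j k _ _ := by
    rw [← op_comp, Linear.units_smul_comp, Linear.comp_units_smul, E.d_comp_d, smul_zero, smul_zero, op_zero]

/-- Differential of the dual complex (definitional). -/
lemma dualComplex_d (E : CochainComplex X.Modules ℤ) (i j : ℤ) :
    (dualComplex X E).d i j = ((j.negOnePow : ℤˣ) • E.d (-j) (-i)).op := rfl

/-- The bicomplex `(q, i) ↦ 𝓗om(K₂^i, K₁^q)` has a total complex (`Mod(𝒪_X)` has all coproducts). -/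
instance (K₁ : CochainComplex X.Modules ℤ) (K₂ : CochainComplex X.Modulesᵒᵖ ℤ) :
    HomologicalComplex.HasMapBifunctor K₁ K₂ (sheafHomBifunctor X).flip (ComplexShape.up ℤ) := inferInstance

/-- **The internal Hom complex** `𝓗om•(E•, F•)`: total complex of the bicomplex
`(q, i) ↦ 𝓗om(E^{-i}, F^q)`, degree-`n` term `∐_{q + i = n} 𝓗om(E^{-i}, F^q) = ∐_p 𝓗om(E^p, F^{p+n})`,
differential `ψ ↦ ψ ≫ d_F + (-1)^{n+1} • d_E ≫ ψ` on `𝓗om(E^p, F^q)` (see `ι_D₁`, `ι_D₂`).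
[cite: StacksProject, More on Algebra, Section «Hom complexes»] -/
abbrev homComplex (E F : CochainComplex X.Modules ℤ) : CochainComplex X.Modules ℤ :=
  HomologicalComplex.mapBifunctor F (dualComplex X E) (sheafHomBifunctor X).flip (ComplexShape.up ℤ)

namespace HomComplex

/-- The inclusion of the summand `𝓗om(E^{-i}, F^q) ⟶ 𝓗om•(E•, F•)^n` (`q + i = n`). -/
abbrev ι (E F : CochainComplex X.Modules ℤ) (q i n : ℤ) (h : q + i = n) :
    sheafHom (E.X (-i)) (F.X q) ⟶ (homComplex X E F).X n :=
  HomologicalComplex.ιMapBifunctor F (dualComplex X E) (sheafHomBifunctor X).flip (ComplexShape.up ℤ) q i n h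

/-- Covariant functoriality in `F•`: `𝓗om•(E•, φ)`. -/
abbrev map (E : CochainComplex X.Modules ℤ) {F F' : CochainComplex X.Modules ℤ} (φ : F ⟶ F') :
    homComplex X E F ⟶ homComplex X E F' :=
  HomologicalComplex.mapBifunctorMap φ (𝟙 (dualComplex X E)) (sheafHomBifunctor X).flip (ComplexShape.up ℤ)

/-- On the summand `𝓗om(E^{-i}, F^q)`, `𝓗om•(E•, φ)` is post-composition with `φ^q`. -/
lemma ι_map (E : CochainComplex X.Modules ℤ) {F F' : CochainComplex X.Modules ℤ} (φ : F ⟶ F')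
    (q i n : ℤ) (h : q + i = n) :
    ι X E F q i n h ≫ (map X E φ).f n = sheafHomMap (E.X (-i)) (φ.f q) ≫ ι X E F' q i n h := by
  refine (HomologicalComplex.ι_mapBifunctorMap φ (𝟙 (dualComplex X E)) (sheafHomBifunctor X).flip
    (ComplexShape.up ℤ) q i n h).trans ?_
  rw [HomologicalComplex.id_f, CategoryTheory.Functor.map_id, Category.id_comp]
  rfl

/-- `𝓗om•(E•, 𝟙) = 𝟙`. -/
lemma map_id (E F : CochainComplex X.Modules ℤ) : map X E (𝟙 F) = 𝟙 _ := by
  simp [map, HomologicalComplex.mapBifunctorMap]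

/-- `𝓗om•(E•, φ ≫ φ') = 𝓗om•(E•, φ) ≫ 𝓗om•(E•, φ')`. -/
lemma map_comp (E : CochainComplex X.Modules ℤ) {F F' F'' : CochainComplex X.Modules ℤ} (φ : F ⟶ F')
    (φ' : F' ⟶ F'') : map X E (φ ≫ φ') = map X E φ ≫ map X E φ' := by
  refine HomologicalComplex.hom_ext _ _ fun n => HomologicalComplex.mapBifunctor.hom_ext fun q i h => ?_
  change ι X E F q i n h ≫ _ = ι X E F q i n h ≫ _
  rw [HomologicalComplex.comp_f, reassoc_of% (ι_map X E φ q i n h), ι_map X E φ' q i n h,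
    ι_map X E (φ ≫ φ') q i n h, HomologicalComplex.comp_f, sheafHomMap_comp, Category.assoc]

/-! ## §3 The differential on summands -/

/-- **`F`-direction**: on the summand `𝓗om(E^{-i}, F^q)` the first differential is post-composition
with `d_F : F^q → F^{q+1}`, with no sign (`ε₁ = 1`). -/
lemma ι_D₁ (E F : CochainComplex X.Modules ℤ) (q i n n' : ℤ) (h : q + i = n) (h' : q + 1 + i = n') :
    ι X E F q i n h ≫
        HomologicalComplex.mapBifunctor.D₁ F (dualComplex X E) (sheafHomBifunctor X).flip (ComplexShape.up ℤ) n n' =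
      sheafHomMap (E.X (-i)) (F.d q (q + 1)) ≫ ι X E F (q + 1) i n' h' := by
  refine (HomologicalComplex.mapBifunctor.ι_D₁ F (dualComplex X E) (sheafHomBifunctor X).flip
    (ComplexShape.up ℤ) n n' q i h).trans ?_
  rw [HomologicalComplex.mapBifunctor.d₁_eq F (dualComplex X E) (sheafHomBifunctor X).flip
    (ComplexShape.up ℤ) (i₁' := q + 1) (by simp) i n' (by simpa using h')]
  exact (one_smul ℤˣ _).trans rfl

/-- **`E`-direction**: on the summand `𝓗om(E^{-i}, F^q)` (total degree `n = q + i`) the second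
differential is `(-1)^{n+1} •` pre-composition with `d_E : E^{-(i+1)} → E^{-i}` (Mathlib's
`ε₂ (q, i) = (-1)^q` times the dual sign `(-1)^{i+1}`). -/
lemma ι_D₂ (E F : CochainComplex X.Modules ℤ) (q i n n' : ℤ) (h : q + i = n) (h' : q + (i + 1) = n') :
    ι X E F q i n h ≫
        HomologicalComplex.mapBifunctor.D₂ F (dualComplex X E) (sheafHomBifunctor X).flip (ComplexShape.up ℤ) n n' =
      ((n + 1).negOnePow : ℤˣ) • (sheafHomMapLeft (E.d (-(i + 1)) (-i)) (F.X q) ≫ ι X E F q (i + 1) n' h') := by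
  refine (HomologicalComplex.mapBifunctor.ι_D₂ F (dualComplex X E) (sheafHomBifunctor X).flip
    (ComplexShape.up ℤ) n n' q i h).trans ?_
  rw [HomologicalComplex.mapBifunctor.d₂_eq F (dualComplex X E) (sheafHomBifunctor X).flip
    (ComplexShape.up ℤ) q (i₂' := i + 1) (by simp) n' (by simpa using h')]
  rw [show ComplexShape.ε₂ (ComplexShape.up ℤ) (ComplexShape.up ℤ) (ComplexShape.up ℤ) (q, i) = q.negOnePow from rfl]
  change (q.negOnePow : ℤˣ) •
      (sheafHomMapLeft (((i + 1).negOnePow : ℤˣ) • E.d (-(i + 1)) (-i)) (F.X q) ≫ ι X E F q (i + 1) n' h') = _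
  rw [sheafHomMapLeft_units_smul, Linear.units_smul_comp, smul_smul, ← Int.negOnePow_add,
    show q + (i + 1) = n + 1 by lia]

/-! ## §4 Homotopy invariance in `F•` (Mathlib `BifunctorHomotopy`) -/

/-- Homotopic maps `φ ∼ φ' : F• → F'•` induce homotopic maps `𝓗om•(E•, φ) ∼ 𝓗om•(E•, φ')`. -/
def mapHomotopy (E : CochainComplex X.Modules ℤ) {F F' : CochainComplex X.Modules ℤ} {φ φ' : F ⟶ F'}
    (h : Homotopy φ φ') : Homotopy (map X E φ) (map X E φ') :=
  HomologicalComplex.mapBifunctorMapHomotopy₁ h (𝟙 (dualComplex X E)) (sheafHomBifunctor X).flip (ComplexShape.up ℤ)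

/-- A homotopy equivalence `F• ≃ₕ F'•` induces `𝓗om•(E•, F•) ≃ₕ 𝓗om•(E•, F'•)` (so a quasi-isomorphism). -/
def mapHomotopyEquiv (E : CochainComplex X.Modules ℤ) {F F' : CochainComplex X.Modules ℤ}
    (e : HomotopyEquiv F F') : HomotopyEquiv (homComplex X E F) (homComplex X E F') where
  hom := map X E e.hom
  inv := map X E e.inv
  homotopyHomInvId := (Homotopy.ofEq (map_comp X E e.hom e.inv).symm).trans
    ((mapHomotopy X E e.homotopyHomInvId).trans (Homotopy.ofEq (map_id X E F)))
  homotopyInvHomId := (Homotopy.ofEq (map_comp X E e.inv e.hom).symm).trans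
    ((mapHomotopy X E e.homotopyInvHomId).trans (Homotopy.ofEq (map_id X E F')))

/-! ## §5 Amplitude: `E• ∈ [a, b]`, `F• ∈ [c, d]` ⟹ `𝓗om•(E•, F•) ∈ [c - b, d - a]` -/

/-- A degree of `𝓗om•(E•, F•)` all of whose summands `𝓗om(E^{-i}, F^q)` (`q + i = n`) vanish is zero. -/
lemma isZero_X (E F : CochainComplex X.Modules ℤ) (n : ℤ)
    (h : ∀ q i : ℤ, q + i = n → IsZero (sheafHom (E.X (-i)) (F.X q))) : IsZero ((homComplex X E F).X n) :=
  (IsZero.iff_id_eq_zero _).2 (HomologicalComplex.mapBifunctor.hom_ext fun q i hqi => (h q i hqi).eq_of_src _ _)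

/-- `𝓗om(E, M) = 0` if `M = 0`. [folklore] -/
lemma isZero_sheafHom_of_isZero_right (E : X.Modules) {M : X.Modules} (hM : IsZero M) : IsZero (sheafHom E M) := by
  rw [IsZero.iff_id_eq_zero, ← sheafHomMap_id E M, hM.eq_of_src (𝟙 M) 0]
  exact (sheafHomFunctor E).map_zero M M

/-- **Lower amplitude bound**: `E• ≤ b`, `F• ≥ c` (strictly) ⟹ `𝓗om•(E•, F•) ≥ c - b`; not an instance
(`b`, `c` are not determined by the conclusion): use `haveI`. -/
theorem isStrictlyGE (E F : CochainComplex X.Modules ℤ) (b c : ℤ) [E.IsStrictlyLE b] [F.IsStrictlyGE c] :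
    (homComplex X E F).IsStrictlyGE (c - b) := by
  rw [CochainComplex.isStrictlyGE_iff]
  intro n hn
  refine isZero_X X E F n fun q i hqi => ?_
  by_cases hq : q < c
  · exact isZero_sheafHom_of_isZero_right X _ (F.isZero_of_isStrictlyGE c q hq)
  · exact isZero_sheafHom_of_isZero (E.isZero_of_isStrictlyLE b (-i) (by lia)) _

/-- **Upper amplitude bound**: `E• ≥ a`, `F• ≤ d` (strictly) ⟹ `𝓗om•(E•, F•) ≤ d - a`; not an instance
(`a`, `d` are not determined by the conclusion): use `haveI`. -/
theorem isStrictlyLE (E F : CochainComplex X.Modules ℤ) (a d : ℤ) [E.IsStrictlyGE a] [F.IsStrictlyLE d] :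
    (homComplex X E F).IsStrictlyLE (d - a) := by
  rw [CochainComplex.isStrictlyLE_iff]
  intro n hn
  refine isZero_X X E F n fun q i hqi => ?_
  by_cases hq : d < q
  · exact isZero_sheafHom_of_isZero_right X _ (F.isZero_of_isStrictlyLE d q hq)
  · exact isZero_sheafHom_of_isZero (E.isZero_of_isStrictlyGE a (-i) (by lia)) _

/-! ## §6 The column case: `𝓗om•(E₀[0], F•) ≅ (q ↦ 𝓗om(E₀, F^q))`, natural in `F•` -/

section Column

variable (E₀ : X.Modules) (F : CochainComplex X.Modules ℤ)

/-- The module `E₀` as a complex concentrated in degree `0`. -/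
abbrev single₀ : CochainComplex X.Modules ℤ := (HomologicalComplex.single X.Modules (ComplexShape.up ℤ) 0).obj E₀

/-- `E₀[0]^{-i} ≅ E₀` for `i = 0`. -/
def single₀XIso (i : ℤ) (hi : i = 0) : (single₀ X E₀).X (-i) ≅ E₀ :=
  HomologicalComplex.singleObjXIsoOfEq (ComplexShape.up ℤ) 0 E₀ (-i) (by lia)

/-- `E₀[0]^{-i} = 0` for `i ≠ 0`. -/
lemma isZero_single₀_X (i : ℤ) (hi : i ≠ 0) : IsZero ((single₀ X E₀).X (-i)) :=
  HomologicalComplex.isZero_single_obj_X (ComplexShape.up ℤ) 0 E₀ (-i) (by lia)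

/-- The dual complex of `E₀[0]` has zero differential. -/
lemma dualComplex_single₀_d (i j : ℤ) : (dualComplex X (single₀ X E₀)).d i j = 0 := by
  rw [dualComplex_d, HomologicalComplex.single_obj_d, smul_zero, op_zero]
  rfl

/-- The column complex `q ↦ 𝓗om(E₀, F^q)`, differential `𝓗om(E₀, d_F)`. -/
abbrev columnComplex : CochainComplex X.Modules ℤ :=
  ((sheafHomFunctor E₀).mapHomologicalComplex (ComplexShape.up ℤ)).obj F

/-- Degree-`n` comparison `𝓗om•(E₀[0], F•)^n ⟶ 𝓗om(E₀, F^n)`: `𝓗om(E₀ ≅ E₀[0]^0, –)` on the summand `(n, 0)`, else `0`. -/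
def columnHom (n : ℤ) : (homComplex X (single₀ X E₀) F).X n ⟶ sheafHom E₀ (F.X n) :=
  HomologicalComplex.mapBifunctorDesc fun q i hqi =>
    if hi : i = 0 then
      sheafHomMapLeft (single₀XIso X E₀ i hi).inv (F.X q) ≫ sheafHomMap E₀ (F.XIsoOfEq (by simp at hqi; lia)).hom
    else 0

/-- Degree-`n` inverse comparison `𝓗om(E₀, F^n) ⟶ 𝓗om(E₀[0]^0, F^n) ⟶ 𝓗om•(E₀[0], F•)^n`. -/
def columnInv (n : ℤ) : sheafHom E₀ (F.X n) ⟶ (homComplex X (single₀ X E₀) F).X n :=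
  sheafHomMapLeft (single₀XIso X E₀ 0 rfl).hom (F.X n) ≫ ι X (single₀ X E₀) F n 0 n (by simp)

/-- `columnHom` on the summand `(n, 0)`. -/
lemma ι_columnHom_zero (n : ℤ) :
    ι X (single₀ X E₀) F n 0 n (by simp) ≫ columnHom X E₀ F n = sheafHomMapLeft (single₀XIso X E₀ 0 rfl).inv (F.X n) := by
  refine (HomologicalComplex.ι_mapBifunctorDesc _ n 0 _).trans ?_
  rw [dif_pos rfl]
  change _ ≫ sheafHomMap E₀ (eqToHom rfl) = _
  rw [eqToHom_refl, sheafHomMap_id, Category.comp_id]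

/-- `columnHom` vanishes on the summands `(q, i)`, `i ≠ 0` (their source is a zero object). -/
lemma ι_columnHom_of_ne (q i n : ℤ) (h : q + i = n) (hi : i ≠ 0) :
    ι X (single₀ X E₀) F q i n h ≫ columnHom X E₀ F n = 0 :=
  (isZero_sheafHom_of_isZero (isZero_single₀_X X E₀ i hi) (F.X q)).eq_of_src _ _

/-- `columnHom ≫ columnInv = 𝟙`. -/
lemma columnHom_columnInv (n : ℤ) : columnHom X E₀ F n ≫ columnInv X E₀ F n = 𝟙 _ := by
  refine HomologicalComplex.mapBifunctor.hom_ext fun q i hqi => ?_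
  change ι X (single₀ X E₀) F q i n hqi ≫ _ = ι X (single₀ X E₀) F q i n hqi ≫ _
  by_cases hi : i = 0
  · subst hi
    obtain rfl : q = n := by simpa using hqi
    rw [reassoc_of% (ι_columnHom_zero X E₀ F q), Category.comp_id, columnInv, ← Category.assoc,
      ← sheafHomMapLeft_comp, Iso.hom_inv_id, sheafHomMapLeft_id, Category.id_comp]
  · exact (isZero_sheafHom_of_isZero (isZero_single₀_X X E₀ i hi) (F.X q)).eq_of_src _ _

/-- `columnInv ≫ columnHom = 𝟙`. -/
lemma columnInv_columnHom (n : ℤ) : columnInv X E₀ F n ≫ columnHom X E₀ F n = 𝟙 _ := by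
  rw [columnInv, Category.assoc, ι_columnHom_zero, ← sheafHomMapLeft_comp, Iso.inv_hom_id, sheafHomMapLeft_id]

/-- Degreewise isomorphism `𝓗om•(E₀[0], F•)^n ≅ 𝓗om(E₀, F^n)`. -/
def columnXIso (n : ℤ) : (homComplex X (single₀ X E₀) F).X n ≅ sheafHom E₀ (F.X n) where
  hom := columnHom X E₀ F n
  inv := columnInv X E₀ F n
  hom_inv_id := columnHom_columnInv X E₀ F n
  inv_hom_id := columnInv_columnHom X E₀ F n

/-- The `E`-direction differential of `𝓗om•(E₀[0], F•)` vanishes (`E₀[0]` has zero differential). -/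
lemma column_D₂_eq_zero (n n' : ℤ) :
    HomologicalComplex.mapBifunctor.D₂ F (dualComplex X (single₀ X E₀)) (sheafHomBifunctor X).flip
      (ComplexShape.up ℤ) n n' = 0 := by
  refine HomologicalComplex.mapBifunctor.hom_ext fun q i hqi => ?_
  rw [comp_zero, HomologicalComplex.mapBifunctor.ι_D₂,
    HomologicalComplex.mapBifunctor.d₂_eq' _ _ _ _ _ (show (ComplexShape.up ℤ).Rel i (i + 1) by simp),
    dualComplex_single₀_d, CategoryTheory.Functor.map_zero, zero_comp, smul_zero]

/-- **The column isomorphism** `𝓗om•(E₀[0], F•) ≅ (q ↦ 𝓗om(E₀, F^q))`: for a complex concentrated in degree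
`0` the internal Hom complex is `𝓗om(E₀, –)` applied termwise (no sign: `ε₁ = 1`). -/
def columnIso : homComplex X (single₀ X E₀) F ≅ columnComplex X E₀ F :=
  HomologicalComplex.Hom.isoOfComponents (fun n => columnXIso X E₀ F n) fun n n' hnn' => by
    obtain rfl : n + 1 = n' := hnn'
    change columnHom X E₀ F n ≫ sheafHomMap E₀ (F.d n (n + 1)) =
      (homComplex X (single₀ X E₀) F).d n (n + 1) ≫ columnHom X E₀ F (n + 1)
    refine HomologicalComplex.mapBifunctor.hom_ext fun q i hqi => ?_
    change ι X (single₀ X E₀) F q i n hqi ≫ _ = ι X (single₀ X E₀) F q i n hqi ≫ _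
    by_cases hi : i = 0
    · subst hi
      obtain rfl : q = n := by simpa using hqi
      rw [reassoc_of% (ι_columnHom_zero X E₀ F q), HomologicalComplex.mapBifunctor.d_eq, Preadditive.add_comp, Preadditive.comp_add,
        column_D₂_eq_zero, zero_comp, comp_zero, add_zero,
        reassoc_of% (ι_D₁ X (single₀ X E₀) F q 0 q (q + 1) (by simp) (by simp)), ι_columnHom_zero]
      exact sheafHomMapLeft_sheafHomMap _ _ _
    · rw [reassoc_of% (ι_columnHom_of_ne X E₀ F q i n hqi hi), zero_comp]
      exact (isZero_sheafHom_of_isZero (isZero_single₀_X X E₀ i hi) (F.X q)).eq_of_src _ _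

variable {F} {F' : CochainComplex X.Modules ℤ} (φ : F ⟶ F')

/-- The column isomorphism is natural in `F•`. -/
lemma columnIso_hom_naturality :
    map X (single₀ X E₀) φ ≫ (columnIso X E₀ F').hom =
      (columnIso X E₀ F).hom ≫ ((sheafHomFunctor E₀).mapHomologicalComplex (ComplexShape.up ℤ)).map φ := by
  refine HomologicalComplex.hom_ext _ _ fun n => ?_
  change (map X (single₀ X E₀) φ).f n ≫ columnHom X E₀ F' n = columnHom X E₀ F n ≫ sheafHomMap E₀ (φ.f n)
  refine HomologicalComplex.mapBifunctor.hom_ext fun q i hqi => ?_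
  change ι X (single₀ X E₀) F q i n hqi ≫ _ = ι X (single₀ X E₀) F q i n hqi ≫ _
  by_cases hi : i = 0
  · subst hi
    obtain rfl : q = n := by simpa using hqi
    rw [reassoc_of% (ι_map X (single₀ X E₀) φ q 0 q hqi), ι_columnHom_zero,
      reassoc_of% (ι_columnHom_zero X E₀ F q)]
    exact (sheafHomMapLeft_sheafHomMap _ _ _).symm
  · rw [reassoc_of% (ι_columnHom_of_ne X E₀ F q i n hqi hi), zero_comp]
    exact (isZero_sheafHom_of_isZero (isZero_single₀_X X E₀ i hi) (F.X q)).eq_of_src _ _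

/-- **`𝓗om•(E₀[0], –)` preserves quasi-isomorphisms** for `E₀` finite locally free: `𝓗om(E₀, –)` is exact
(`preservesHomology_sheafHomFunctor`), so it preserves quasi-isomorphisms termwise (Mathlib
`quasiIso_map_of_preservesHomology`), and `𝓗om•(E₀[0], F•) ≅ 𝓗om(E₀, F•)` naturally (`columnIso`). This is the
base case of «bounded strictly perfect `E•` ⟹ `𝓗om•(E•, –)` preserves quasi-isomorphisms».
[cite: Hartshorne1977, II Ex. 5.1 (b) and III.6 (proof of Prop. 6.5)] -/
theorem quasiIso_map_single₀ (hE₀ : IsFiniteLocallyFree E₀) [QuasiIso φ] :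
    QuasiIso (map X (single₀ X E₀) φ) := by
  haveI := preservesHomology_sheafHomFunctor E₀ hE₀
  refine quasiIso_of_arrow_mk_iso (((sheafHomFunctor E₀).mapHomologicalComplex (ComplexShape.up ℤ)).map φ)
    (map X (single₀ X E₀) φ) (Arrow.isoMk (columnIso X E₀ F).symm (columnIso X E₀ F').symm ?_)
  change (columnIso X E₀ F).inv ≫ map X (single₀ X E₀) φ =
    ((sheafHomFunctor E₀).mapHomologicalComplex (ComplexShape.up ℤ)).map φ ≫ (columnIso X E₀ F').inv
  rw [Iso.inv_comp_eq, ← Category.assoc, Iso.eq_comp_inv, columnIso_hom_naturality]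

end Column

end HomComplex

end Summit.Ventures.HSemireg

end
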